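/-
Copyright (c) 2026. All rights reserved.
Released under Apache 2.0 license as described in the file LICENSE.
Authors: abc-iut cell, prover seat abc-iut-w6-d031 (gen 5; PROOF-ONLY: parabolic elements of `SL₂(ℝ)`
are conjugate to translations of `ℍ` — input of the cusp analysis of abstract Möbius deck groups).
-/
import Mathlib.Analysis.Complex.UpperHalfPlane.MoebiusAction
import HarnessLib

/-!
# Parabolic elements of `SL₂(ℝ)` are conjugate to translations of `ℍ`

A. F. Beardon, *The Geometry of Discrete Groups* (1983), §4.3 (conjugacy classes of Möbius
transformations): a non-trivial Möbius transformation with `(tr)² = 4` is parabolic and conjugate to a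
translation.  PROOF-ONLY (no definitions, no named facts), for `SL(2, ℝ)` acting on `ℍ` (Mathlib):

* `SL2R.exists_conj_upper_of_eigenvector` — a real eigenvector `(p, q) ≠ 0` of `t`, `t (p,q)ᵀ = ε (p,q)ᵀ`,
  gives `A ∈ SL(2, ℝ)` with `(A t A⁻¹)₁₀ = 0` and `(A t A⁻¹)₀₀ = ε`;
* ★ `SL2R.exists_conj_smul_eq_add` — `(t₀₀ + t₁₁)² = 4` ⇒ `∃ A ∈ SL(2, ℝ)`, `∃ s ∈ ℝ`,
  `(A t A⁻¹) • z = z + s` for all `z ∈ ℍ`.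

Companion of abc-iut-w6-d031's `SL2Z.exists_conj_smul_eq_add` (integer version, for `Γ(2)`); used to
straighten the cusp of a parabolic element of an arbitrary discrete `Λ̄ ≤ PSL₂(ℝ)`.

## References

* A. F. Beardon, *The Geometry of Discrete Groups*, GTM 91 (1983), Section 4.3. [Beardon1983]
-/

set_option autoImplicit false

noncomputable section

open Matrix Matrix.SpecialLinearGroup UpperHalfPlane
open scoped MatrixGroups

namespace Literature.Analysis.Complex

namespace SL2R

/-- **Conjugating a real eigenvector to `e₁`.**  If `(p, q) ≠ 0` with `t (p, q)ᵀ = ε (p, q)ᵀ`, then for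
`A = [[x, y], [-q, p]]` with `x p + y q = 1` the conjugate `A t A⁻¹` has first column `(ε, 0)ᵀ`.
[cite: Beardon1983, Section 4.3] -/
theorem exists_conj_upper_of_eigenvector (t : SL(2, ℝ)) {ε p q : ℝ} (hpq : p ≠ 0 ∨ q ≠ 0)
    (h0 : t 0 0 * p + t 0 1 * q = ε * p) (h1 : t 1 0 * p + t 1 1 * q = ε * q) :
    ∃ A : SL(2, ℝ), (A * t * A⁻¹) 1 0 = 0 ∧ (A * t * A⁻¹) 0 0 = ε := by
  have hn : p ^ 2 + q ^ 2 ≠ 0 := by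
    intro h0
    have hp2 : p ^ 2 = 0 := by nlinarith [sq_nonneg p, sq_nonneg q]
    have hq2 : q ^ 2 = 0 := by nlinarith [sq_nonneg p, sq_nonneg q]
    rcases hpq with h | h
    · exact h (pow_eq_zero_iff two_ne_zero |>.mp hp2)
    · exact h (pow_eq_zero_iff two_ne_zero |>.mp hq2)
  set x : ℝ := p / (p ^ 2 + q ^ 2) with hx
  set y : ℝ := q / (p ^ 2 + q ^ 2) with hy
  have hxy : x * p + y * q = 1 := by
    rw [hx, hy]; field_simp
  let A : SL(2, ℝ) := ⟨!![x, y; -q, p], by rw [Matrix.det_fin_two_of]; linarith⟩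
  refine ⟨A, ?_, ?_⟩
  all_goals
    have hAinv : ((A⁻¹ : SL(2, ℝ)) : Matrix (Fin 2) (Fin 2) ℝ) = !![p, -y; q, x] := by
      rw [Matrix.SpecialLinearGroup.coe_inv]
      show Matrix.adjugate !![x, y; -q, p] = _
      rw [Matrix.adjugate_fin_two_of]
      simp
    have hA00 : ((A : SL(2, ℝ)) : Matrix (Fin 2) (Fin 2) ℝ) 0 0 = x := rfl
    have hA01 : ((A : SL(2, ℝ)) : Matrix (Fin 2) (Fin 2) ℝ) 0 1 = y := rfl
    have hA10 : ((A : SL(2, ℝ)) : Matrix (Fin 2) (Fin 2) ℝ) 1 0 = -q := rfl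
    have hA11 : ((A : SL(2, ℝ)) : Matrix (Fin 2) (Fin 2) ℝ) 1 1 = p := rfl
    have hAi00 : ((A⁻¹ : SL(2, ℝ)) : Matrix (Fin 2) (Fin 2) ℝ) 0 0 = p := by rw [hAinv]; rfl
    have hAi10 : ((A⁻¹ : SL(2, ℝ)) : Matrix (Fin 2) (Fin 2) ℝ) 1 0 = q := by rw [hAinv]; rfl
  · show ((A * t * A⁻¹ : SL(2, ℝ)) : Matrix (Fin 2) (Fin 2) ℝ) 1 0 = 0
    rw [Matrix.SpecialLinearGroup.coe_mul, Matrix.SpecialLinearGroup.coe_mul, Matrix.mul_apply,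
      Fin.sum_univ_two, Matrix.mul_apply, Matrix.mul_apply, Fin.sum_univ_two, Fin.sum_univ_two,
      hA10, hA11, hAi00, hAi10]
    linear_combination (-q) * h0 + p * h1
  · show ((A * t * A⁻¹ : SL(2, ℝ)) : Matrix (Fin 2) (Fin 2) ℝ) 0 0 = ε
    rw [Matrix.SpecialLinearGroup.coe_mul, Matrix.SpecialLinearGroup.coe_mul, Matrix.mul_apply,
      Fin.sum_univ_two, Matrix.mul_apply, Matrix.mul_apply, Fin.sum_univ_two, Fin.sum_univ_two,
      hA00, hA01, hAi00, hAi10]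
    linear_combination x * h0 + y * h1 + ε * hxy

/-- ★ **A trace-`±2` element of `SL(2, ℝ)` is conjugate to a translation of `ℍ`**: if
`(t₀₀ + t₁₁)² = 4` then `∃ A ∈ SL(2, ℝ)`, `∃ s ∈ ℝ`, `(A t A⁻¹) • z = z + s` for all `z ∈ ℍ`
(conjugate a real eigenvector of `t` — eigenvalue `ε = ±1` — to `e₁`; the conjugate is `±[[1, s], [0, 1]]`).
[cite: Beardon1983, Section 4.3] -/
theorem exists_conj_smul_eq_add (t : SL(2, ℝ)) (htr : (t 0 0 + t 1 1) ^ 2 = 4) :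
    ∃ (A : SL(2, ℝ)) (s : ℝ), ∀ z : ℍ, (((A * t * A⁻¹) • z : ℍ) : ℂ) = z + s := by
  -- `a + d = 2ε`, `ε = ±1`
  obtain ⟨ε, hε, had⟩ : ∃ ε : ℝ, ε ^ 2 = 1 ∧ t 0 0 + t 1 1 = 2 * ε := by
    have h : (t 0 0 + t 1 1 - 2) * (t 0 0 + t 1 1 + 2) = 0 := by nlinarith [htr]
    rcases mul_eq_zero.mp h with h | h
    · exact ⟨1, by norm_num, by linarith⟩
    · exact ⟨-1, by norm_num, by linarith⟩
  have hdet := t.det_coe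
  rw [Matrix.det_fin_two] at hdet
  -- an eigenvector for `ε`: `(b, ε - a)`, or `(0, 1)` if that vanishes
  obtain ⟨A, hA10, hA00⟩ : ∃ A : SL(2, ℝ), (A * t * A⁻¹) 1 0 = 0 ∧ (A * t * A⁻¹) 0 0 = ε := by
    by_cases hcase : t 0 1 = 0 ∧ t 0 0 = ε
    · obtain ⟨hb, ha⟩ := hcase
      refine exists_conj_upper_of_eigenvector t (ε := ε) (p := 0) (q := 1) (Or.inr one_ne_zero) ?_ ?_
      · rw [hb]; ring
      · have hd : t 1 1 = ε := by linarith
        rw [hd]; ring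
    · have hv : t 0 1 ≠ 0 ∨ ε - t 0 0 ≠ 0 := by
        by_contra h
        push Not at h
        exact hcase ⟨h.1, by linarith [h.2]⟩
      refine exists_conj_upper_of_eigenvector t (ε := ε) (p := t 0 1) (q := ε - t 0 0) hv ?_ ?_
      · ring
      · have h2 : ε * (t 0 0 + t 1 1) = 2 := by rw [had]; nlinarith [hε]
        linear_combination (-1 : ℝ) * hdet + h2 - hε
  set M : SL(2, ℝ) := A * t * A⁻¹ with hM
  have hMdet := M.det_coe
  rw [Matrix.det_fin_two, hA10, mul_zero, sub_zero, hA00] at hMdet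
  have hε0 : ε ≠ 0 := by rintro rfl; norm_num at hε
  have hM11 : M 1 1 = ε := by
    have : ε * M 1 1 = ε * ε := by rw [hMdet]; nlinarith [hε]
    exact mul_left_cancel₀ hε0 this
  refine ⟨A, ε * M 0 1, fun z => ?_⟩
  rw [← hM, UpperHalfPlane.coe_specialLinearGroup_apply]
  simp only [Algebra.algebraMap_self, RingHom.id_apply]
  rw [hA10, hA00, hM11]
  have hεC : (ε : ℂ) ≠ 0 := by exact_mod_cast hε0
  have hε2 : (ε : ℂ) * ε = 1 := by exact_mod_cast (by nlinarith [hε] : ε * ε = 1)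
  push_cast
  rw [zero_mul, zero_add, div_eq_iff hεC]
  linear_combination (-(((M : Matrix (Fin 2) (Fin 2) ℝ) 0 1 : ℝ) : ℂ)) * hε2

end SL2R

end Literature.Analysis.Complex

end
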